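import Literature.LinearAlgebra.Matrix.LoewnerFormKernelRealRoots

/-!
# Finite sections of the quadratic form of a distribution on `[0, L]` are divided-difference matrices
# (Connes–van Suijlekom 2025, §4: (4.2)–(4.5), Proposition 4.1; with §5–§6: real zeros of the finite sections)

Source, read verbatim (held text `paper:arxiv-2511.23257`): A. Connes, W. D. van Suijlekom, *Quadratic
Forms, Real Zeros and Echoes of the Spectral Action*, Comm. Math. Phys. **406** (2025) = arXiv:2511.23257
[bib: `ConnesSuijlekom2025`], Section 4 "Quadratic form `Q` associated to a distribution", and the first
lines of the proof of Theorem 6.1 (p. 11: the finite sections `Q_N` on `E_N = span{U_{-N}, …, U_N}`).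

Printed setting (§4). `L > 0`; `𝒟` a (real) distribution on `[0, L]`; `𝒟̃(f) := 𝒟(f) + 𝒟(f(-·))` its
symmetrisation (4.1); `U_n(x) := L^{-1/2} e^{2πinx/L}` on `[0, L]`, extended by `0` (4.2); involution
`f^*(x) := conj f(-x)` and convolution `(f ∗ g)(y) := ∫ f(x) g(y - x) dx`; the hermitian form
`⟨f ∣ g⟩_Q := 𝒟̃(f^* ∗ g)` (4.3), with matrix `⟨U_m ∣ U_n⟩_Q = ∫_0^L ((U_m^* ∗ U_n)(y) + (U_m^* ∗ U_n)(-y)) 𝒟(y) dy`.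
§4.1 computes, for `y ∈ [0, L]`,
`(U_m^* ∗ U_n)(y) = (e^{2πimy/L} - e^{2πiny/L})/(2πi(n-m))` (`n ≠ m`), `(U_n^* ∗ U_n)(y) = (1 - y/L) e^{2πiny/L}`,
`(U_m^* ∗ U_n)(-y) = conj((U_n^* ∗ U_m)(y))`, hence (4.4)
`(U_m^* ∗ U_n)(y) + (U_m^* ∗ U_n)(-y) = (sin(2πmy/L) - sin(2πny/L))/(π(n-m))` and (4.5)
`(U_n^* ∗ U_n)(y) + (U_n^* ∗ U_n)(-y) = 2(1 - y/L) cos(2πny/L)`.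

> **Proposition 4.1.** Let `𝒟` be as above and `Q` the quadratic form (4.3). Let
> `ψ(x) := (1/π) ∫_0^L sin(2πx(1 - y/L)) 𝒟(y) dy`. The matrix elements `q_{m,n}` of `Q` are
> `q_{m,n} = (ψ(m) - ψ(n))/(m - n)` if `n ≠ m`, and `ψ'(n)` if `n = m`.

## What is here

* `trigBasis L n` = `U_n` (4.2); `autocorr L m n y = ∫ conj(U_m(x - y)) U_n(x) dx = (U_m^* ∗ U_n)(y)`;
  `symAutocorr L m n y` = the symmetrised kernel `(U_m^* ∗ U_n)(y) + (U_m^* ∗ U_n)(-y)` entering (4.3);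
  `sectionMatrix D L S` = the finite section `(D(symAutocorr_{mn}))_{m, n ∈ S}` of the form (4.3) of a
  real-linear functional `D`.
* §4.1 as printed: `autocorr_neg` (`(U_m^* ∗ U_n)(-y) = conj (U_n^* ∗ U_m)(y)`), `autocorr_of_mem` (the two
  closed forms on `[0, L]`), `symAutocorr_of_ne` = (4.4), `symAutocorr_self` = (4.5); the values at the
  two edges: `symAutocorr_zero` (`= 2δ_{mn}`: the remark after (4.3) that `δ_0` contributes `2·Id`) and
  `symAutocorr_right_edge` (`= 0` at `y = L`).
* Prop. 4.1 for an ARBITRARY real-linear functional `D` on functions `ℝ → ℝ` that sees a function only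
  through its restriction to `[0, L]` (a distribution on `[0, L]` is one such; only linearity is used):
  `functional_symAutocorr_of_ne` (off-diagonal entries `= (ψ(m) - ψ(n))/(m - n)` with
  `ψ(m) = D(y ↦ sin(2πm(1 - y/L)))/π`) and `functional_symAutocorr_self` (diagonal entries
  `= D(y ↦ 2(1 - y/L)cos(2πny/L))`; the printed `ψ'(n)` is this number when `D` commutes with `d/dx`,
  which is not asserted here).
* The finite-section statement obtained by combining Prop. 4.1 with the finite-dimensional Thm. 5.6 of
  `Literature/LinearAlgebra/Matrix/LoewnerFormKernelRealRoots.lean` (this combination is the step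
  "the finite sections have the special form of Prop. 4.1 … Thm. 5.6" of the proof of C–vS Thm. 6.1, and
  the finite-`N` content of Connes–Consani–Moscovici, *Zeta spectral triples*, Thm. 5.10 (iii) once `D`
  is Weil's distribution — which is NOT formalised here): `functional_finiteSection_zeros_real` — for ANY
  such `D` and any finite set `S = -S` of frequencies, if the smallest eigenvalue `ε` of `sectionMatrix D L S`
  is simple with EVEN eigenvector `ξ` (stated as: `sectionMatrix - ε` positive semidefinite with kernel `ℝξ`,
  `ξ_{-k} = ξ_k`), then every zero of `∫_0^L (Σ_k ξ_k e^{2πikx/L}) e^{-izx} dx` is real.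

* The same statement in the Connes–Consani–Moscovici normalisation (multiplicative window
  `[λ⁻¹, λ]`, `L = 2 log λ`, `V_k(u) = U_k(log(λu))`, `F_μ(f)(z) = ∫ f(u) u^{-iz} d^*u`; CCM Prop. 5.9's
  substitution `x = log(λu)`): `functional_finiteSection_mulFourier_zeros_real`.

Deliberately NOT here: distributions as such (no topology on test functions is used), Weil's
distribution / `QW_λ`, Prop. 4.2 (every divided-difference matrix arises from some `𝒟`), §4.3 (spectral
action), the infinite-dimensional Thm. 6.1 (see
`Literature.NumberTheory.LFunctions.Connes2026_weilGroundState_zeros_re_eq_half_holds`), RH.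
-/

noncomputable section

open Set MeasureTheory Complex Finset

open scoped ComplexConjugate Real

namespace Literature.Analysis.Fourier

namespace ConnesVanSuijlekom

/-! ## The basis `U_n` and the autocorrelations `U_m^* ∗ U_n` -/

/-- `U_n(x) = L^{-1/2} exp(2πinx/L)` for `x ∈ [0, L]`, extended by `0` to `ℝ` (C–vS (4.2)).
[cite: ConnesSuijlekom2025, eq. (4.2)] -/
def trigBasis (L : ℝ) (n : ℤ) : ℝ → ℂ :=
  (Icc 0 L).indicator fun x => (((Real.sqrt L)⁻¹ : ℝ) : ℂ) * cexp (((2 * π * n * x / L : ℝ) : ℂ) * I)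

/-- `(U_m^* ∗ U_n)(y) = ∫ conj(U_m(x - y)) U_n(x) dx`, with `f^*(x) = conj f(-x)` and
`(f ∗ g)(y) = ∫ f(x) g(y - x) dx` as in C–vS §4 (the first displayed line of §4.1).
[cite: ConnesSuijlekom2025, §4.1] -/
def autocorr (L : ℝ) (m n : ℤ) (y : ℝ) : ℂ :=
  ∫ x : ℝ, conj (trigBasis L m (x - y)) * trigBasis L n x

/-- The symmetrised kernel `(U_m^* ∗ U_n)(y) + (U_m^* ∗ U_n)(-y)` whose pairing with `𝒟` is the matrix
element `⟨U_m ∣ U_n⟩_Q` (C–vS (4.3)). [cite: ConnesSuijlekom2025, eq. (4.3)] -/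
def symAutocorr (L : ℝ) (m n : ℤ) (y : ℝ) : ℂ :=
  autocorr L m n y + autocorr L m n (-y)

/-- The finite section on a finite set `S` of frequencies of the form (4.3) of a real-linear functional
`D` (playing `𝒟`): `q_{mn} = D(y ↦ (U_m^* ∗ U_n)(y) + (U_m^* ∗ U_n)(-y))` (the kernel is real on `[0, L]`
by (4.4)–(4.5); `D` is applied to its real part). [cite: ConnesSuijlekom2025, eq. (4.3) and proof of Thm. 6.1 (the sections Q_N)] -/
def sectionMatrix (D : (ℝ → ℝ) →ₗ[ℝ] ℝ) (L : ℝ) (S : Finset ℤ) : Matrix S S ℝ :=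
  Matrix.of fun m n : S => D fun y => (symAutocorr L m n y).re

/-- Unfolding of `trigBasis` on `[0, L]`. [cite: ConnesSuijlekom2025, eq. (4.2)] -/
theorem trigBasis_of_mem {L : ℝ} (n : ℤ) {x : ℝ} (hx : x ∈ Icc 0 L) :
    trigBasis L n x = (((Real.sqrt L)⁻¹ : ℝ) : ℂ) * cexp (((2 * π * n * x / L : ℝ) : ℂ) * I) := by
  rw [trigBasis, indicator_of_mem hx]

/-- `U_n` vanishes off `[0, L]`. [cite: ConnesSuijlekom2025, eq. (4.2)] -/
theorem trigBasis_of_not_mem {L : ℝ} (n : ℤ) {x : ℝ} (hx : x ∉ Icc 0 L) : trigBasis L n x = 0 := by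
  rw [trigBasis, indicator_of_notMem hx]

/-- Conjugating a pure phase: `conj e^{iθ} = e^{-iθ}` (`θ` real). [folklore] -/
private theorem conj_cexp_mul_I (θ : ℝ) : conj (cexp ((θ : ℂ) * I)) = cexp (-((θ : ℂ) * I)) := by
  rw [← exp_conj, map_mul, conj_ofReal, conj_I, mul_neg]

/-- `e^{iθ} - e^{-iθ} = 2i sin θ`. [folklore] -/
private theorem cexp_sub_cexp_neg (θ : ℝ) :
    cexp ((θ : ℂ) * I) - cexp (-((θ : ℂ) * I)) = 2 * I * (Real.sin θ : ℂ) := by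
  rw [← Complex.cos_add_sin_I, show -((θ : ℂ) * I) = -(θ : ℂ) * I by ring, ← Complex.cos_sub_sin_I,
    Complex.ofReal_sin]
  ring

/-- `e^{iθ} + e^{-iθ} = 2 cos θ`. [folklore] -/
private theorem cexp_add_cexp_neg (θ : ℝ) :
    cexp ((θ : ℂ) * I) + cexp (-((θ : ℂ) * I)) = 2 * (Real.cos θ : ℂ) := by
  rw [← Complex.cos_add_sin_I, show -((θ : ℂ) * I) = -(θ : ℂ) * I by ring, ← Complex.cos_sub_sin_I,
    Complex.ofReal_cos]
  ring

/-- **§4.1, second display:** `(U_m^* ∗ U_n)(-y) = conj ((U_n^* ∗ U_m)(y))` (for every real `y`).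
[cite: ConnesSuijlekom2025, §4.1] -/
theorem autocorr_neg (L : ℝ) (m n : ℤ) (y : ℝ) :
    autocorr L m n (-y) = conj (autocorr L n m y) := by
  unfold autocorr
  rw [← integral_conj, ← integral_add_right_eq_self
    (fun x => conj (conj (trigBasis L n (x - y)) * trigBasis L m x)) y]
  congr 1
  funext x
  simp only [map_mul, conj_conj, sub_neg_eq_add, add_sub_cancel_right]
  ring

/-- **§4.1, first display (closed forms on `[0, L]`).** For `L > 0` and `y ∈ [0, L]`:
`(U_m^* ∗ U_n)(y) = (e^{2πimy/L} - e^{2πiny/L})/(2πi(n - m))` if `n ≠ m`, and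
`(U_n^* ∗ U_n)(y) = (1 - y/L) e^{2πiny/L}`. [cite: ConnesSuijlekom2025, §4.1] -/
theorem autocorr_of_mem {L : ℝ} (hL : 0 < L) (m n : ℤ) {y : ℝ} (hy : y ∈ Icc 0 L) :
    autocorr L m n y =
      if m = n then ((1 - y / L : ℝ) : ℂ) * cexp (((2 * π * m * y / L : ℝ) : ℂ) * I)
      else (cexp (((2 * π * m * y / L : ℝ) : ℂ) * I) - cexp (((2 * π * n * y / L : ℝ) : ℂ) * I))
        / (2 * π * I * (n - m)) := by
  have hL0 : (L : ℂ) ≠ 0 := by exact_mod_cast hL.ne'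
  have hπ : (π : ℂ) ≠ 0 := by exact_mod_cast Real.pi_ne_zero
  have hsq : ((Real.sqrt L)⁻¹ : ℝ) * (Real.sqrt L)⁻¹ = L⁻¹ := by
    rw [← mul_inv, Real.mul_self_sqrt hL.le]
  -- the integrand is supported on `[y, L]`, where it equals `C e^{κ x}`, `κ = 2πi(n-m)/L`,
  -- `C = L⁻¹ e^{2πimy/L}`
  obtain ⟨κ, hκ⟩ : ∃ κ : ℂ, κ = ((2 * π * (n - m) / L : ℝ) : ℂ) * I := ⟨_, rfl⟩
  obtain ⟨C, hC⟩ : ∃ C : ℂ, C = ((L⁻¹ : ℝ) : ℂ) * cexp (((2 * π * m * y / L : ℝ) : ℂ) * I) := ⟨_, rfl⟩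
  have hpt : ∀ x, conj (trigBasis L m (x - y)) * trigBasis L n x
      = (Icc y L).indicator (fun x => C * cexp (κ * x)) x := by
    intro x
    by_cases hx : x ∈ Icc y L
    · have h1 : x - y ∈ Icc 0 L := ⟨by linarith [hx.1], by linarith [hx.2, hy.1]⟩
      have h2 : x ∈ Icc 0 L := ⟨by linarith [hx.1, hy.1], hx.2⟩
      rw [indicator_of_mem hx, trigBasis_of_mem m h1, trigBasis_of_mem n h2, map_mul, conj_ofReal,
        conj_cexp_mul_I]
      have e : cexp (-(((2 * π * m * (x - y) / L : ℝ) : ℂ) * I)) * cexp (((2 * π * n * x / L : ℝ) : ℂ) * I)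
          = cexp (((2 * π * m * y / L : ℝ) : ℂ) * I) * cexp (κ * x) := by
        rw [← Complex.exp_add, ← Complex.exp_add, hκ]
        congr 1
        push_cast
        ring
      calc (((Real.sqrt L)⁻¹ : ℝ) : ℂ) * cexp (-(((2 * π * m * (x - y) / L : ℝ) : ℂ) * I))
            * ((((Real.sqrt L)⁻¹ : ℝ) : ℂ) * cexp (((2 * π * n * x / L : ℝ) : ℂ) * I))
          = ((((Real.sqrt L)⁻¹ : ℝ) : ℂ) * (((Real.sqrt L)⁻¹ : ℝ) : ℂ))
            * (cexp (-(((2 * π * m * (x - y) / L : ℝ) : ℂ) * I))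
              * cexp (((2 * π * n * x / L : ℝ) : ℂ) * I)) := by ring
        _ = ((L⁻¹ : ℝ) : ℂ) * (cexp (((2 * π * m * y / L : ℝ) : ℂ) * I) * cexp (κ * x)) := by
            rw [e, ← ofReal_mul, hsq]
        _ = C * cexp (κ * x) := by rw [hC]; ring
    · rw [indicator_of_notMem hx]
      rw [Set.mem_Icc, not_and_or, not_le, not_le] at hx
      rcases hx with h | h
      · rw [trigBasis_of_not_mem m (fun h' => by linarith [h'.1]), map_zero, zero_mul]
      · rw [trigBasis_of_not_mem n (fun h' => by linarith [h'.2]), mul_zero]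
  have hI : autocorr L m n y = ∫ x in y..L, C * cexp (κ * x) := by
    unfold autocorr
    rw [show (fun x => conj (trigBasis L m (x - y)) * trigBasis L n x)
        = (Icc y L).indicator (fun x => C * cexp (κ * x)) from funext hpt,
      integral_indicator measurableSet_Icc, integral_Icc_eq_integral_Ioc,
      ← intervalIntegral.integral_of_le hy.2]
  rw [hI]
  by_cases hmn : m = n
  · subst hmn
    have hκ0 : κ = 0 := by rw [hκ]; push_cast; ring
    rw [if_pos rfl, hκ0]
    simp only [zero_mul, Complex.exp_zero, mul_one, intervalIntegral.integral_const, Complex.real_smul,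
      hC]
    push_cast
    field_simp
  · have hnm : ((n : ℂ) - (m : ℂ)) ≠ 0 := by
      rw [sub_ne_zero]
      exact_mod_cast (Ne.symm hmn)
    have hκ0 : κ ≠ 0 := by
      rw [hκ]
      push_cast
      exact mul_ne_zero (div_ne_zero (mul_ne_zero (mul_ne_zero two_ne_zero hπ) hnm) hL0) I_ne_zero
    rw [if_neg hmn, intervalIntegral.integral_const_mul, integral_exp_mul_complex hκ0]
    have e1 : cexp (κ * (L : ℝ)) = 1 := by
      rw [hκ, ← Complex.exp_int_mul_two_pi_mul_I (n - m)]
      congr 1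
      push_cast
      field_simp
    have e2 : cexp (((2 * π * m * y / L : ℝ) : ℂ) * I) * cexp (κ * (y : ℝ))
        = cexp (((2 * π * n * y / L : ℝ) : ℂ) * I) := by
      rw [← Complex.exp_add, hκ]
      congr 1
      push_cast
      field_simp
      ring
    rw [e1]
    calc C * ((1 - cexp (κ * (y : ℝ))) / κ)
        = ((L⁻¹ : ℝ) : ℂ) * (cexp (((2 * π * m * y / L : ℝ) : ℂ) * I)
            - cexp (((2 * π * m * y / L : ℝ) : ℂ) * I) * cexp (κ * (y : ℝ))) / κ := by
          rw [hC]; ring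
      _ = ((L⁻¹ : ℝ) : ℂ) * (cexp (((2 * π * m * y / L : ℝ) : ℂ) * I)
            - cexp (((2 * π * n * y / L : ℝ) : ℂ) * I)) / κ := by rw [e2]
      _ = _ := by
          rw [hκ, div_eq_div_iff (by rw [← hκ]; exact hκ0) (mul_ne_zero (mul_ne_zero (mul_ne_zero
            two_ne_zero hπ) I_ne_zero) hnm)]
          push_cast
          field_simp

/-- **C–vS (4.4).** For `L > 0`, `n ≠ m` and `y ∈ [0, L]`:
`(U_m^* ∗ U_n)(y) + (U_m^* ∗ U_n)(-y) = (sin(2πmy/L) - sin(2πny/L))/(π(n - m))` (a real number).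
[cite: ConnesSuijlekom2025, eq. (4.4)] -/
theorem symAutocorr_of_ne {L : ℝ} (hL : 0 < L) {m n : ℤ} (hmn : m ≠ n) {y : ℝ} (hy : y ∈ Icc 0 L) :
    symAutocorr L m n y
      = (((Real.sin (2 * π * m * y / L) - Real.sin (2 * π * n * y / L)) / (π * (n - m)) : ℝ) : ℂ) := by
  have hπ : (π : ℂ) ≠ 0 := by exact_mod_cast Real.pi_ne_zero
  have hnm : ((n : ℂ) - (m : ℂ)) ≠ 0 := by
    rw [sub_ne_zero]
    exact_mod_cast (Ne.symm hmn)
  have hd : conj (2 * (π : ℂ) * I * ((m : ℂ) - (n : ℂ))) = 2 * (π : ℂ) * I * ((n : ℂ) - (m : ℂ)) := by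
    simp only [map_mul, map_sub, map_ofNat, conj_ofReal, conj_I, map_intCast]
    ring
  rw [symAutocorr, autocorr_neg, autocorr_of_mem hL m n hy, autocorr_of_mem hL n m hy, if_neg hmn,
    if_neg (Ne.symm hmn), map_div₀, hd, map_sub, conj_cexp_mul_I, conj_cexp_mul_I, ← add_div,
    show cexp (((2 * π * m * y / L : ℝ) : ℂ) * I) - cexp (((2 * π * n * y / L : ℝ) : ℂ) * I)
        + (cexp (-(((2 * π * n * y / L : ℝ) : ℂ) * I)) - cexp (-(((2 * π * m * y / L : ℝ) : ℂ) * I)))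
      = (cexp (((2 * π * m * y / L : ℝ) : ℂ) * I) - cexp (-(((2 * π * m * y / L : ℝ) : ℂ) * I)))
        - (cexp (((2 * π * n * y / L : ℝ) : ℂ) * I) - cexp (-(((2 * π * n * y / L : ℝ) : ℂ) * I))) by
      ring,
    cexp_sub_cexp_neg, cexp_sub_cexp_neg]
  push_cast
  rw [div_eq_div_iff (mul_ne_zero (mul_ne_zero (mul_ne_zero two_ne_zero hπ) I_ne_zero) hnm)
    (mul_ne_zero hπ hnm)]
  ring

/-- **C–vS (4.5).** For `L > 0` and `y ∈ [0, L]`: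
`(U_n^* ∗ U_n)(y) + (U_n^* ∗ U_n)(-y) = 2(1 - y/L) cos(2πny/L)`. [cite: ConnesSuijlekom2025, eq. (4.5)] -/
theorem symAutocorr_self {L : ℝ} (hL : 0 < L) (n : ℤ) {y : ℝ} (hy : y ∈ Icc 0 L) :
    symAutocorr L n n y = ((2 * (1 - y / L) * Real.cos (2 * π * n * y / L) : ℝ) : ℂ) := by
  rw [symAutocorr, autocorr_neg, autocorr_of_mem hL n n hy, if_pos rfl, map_mul, conj_ofReal,
    conj_cexp_mul_I, ← mul_add, cexp_add_cexp_neg]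
  push_cast
  ring

/-- At `y = 0` the symmetrised kernel is `2δ_{mn}`: pairing with the Dirac mass `δ_0` gives twice
the identity matrix ("for `𝒟 = δ_0` … `= 2⟨U_m ∣ U_n⟩`, which shows that by adding to `𝒟` a multiple of
`δ_0` one can assume that the quadratic form `Q` is positive", C–vS after (4.3)).
[cite: ConnesSuijlekom2025, §4 (remark following eq. (4.3))] -/
theorem symAutocorr_zero {L : ℝ} (hL : 0 < L) (m n : ℤ) :
    symAutocorr L m n 0 = if m = n then 2 else 0 := by
  have h0 : (0 : ℝ) ∈ Icc 0 L := ⟨le_rfl, hL.le⟩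
  by_cases hmn : m = n
  · subst hmn
    rw [symAutocorr_self hL m h0, if_pos rfl]
    simp
  · rw [symAutocorr_of_ne hL hmn h0, if_neg hmn]
    simp

/-- At the right edge `y = L` the symmetrised kernel vanishes for all `m, n` (so an atom of `𝒟` at
`y = L` does not contribute to the matrix; cf. Connes–Consani–Moscovici, *Zeta spectral triples*,
Lemma 2.3). [cite: ConnesSuijlekom2025, eqs. (4.4)–(4.5) at y = L] -/
theorem symAutocorr_right_edge {L : ℝ} (hL : 0 < L) (m n : ℤ) : symAutocorr L m n L = 0 := by
  have hLm : L ∈ Icc 0 L := ⟨hL.le, le_rfl⟩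
  by_cases hmn : m = n
  · subst hmn
    rw [symAutocorr_self hL m hLm, div_self hL.ne']
    simp
  · rw [symAutocorr_of_ne hL hmn hLm]
    have h : ∀ k : ℤ, Real.sin (2 * π * k * L / L) = 0 := fun k => by
      rw [mul_div_assoc, div_self hL.ne', mul_one, show 2 * π * (k : ℝ) = k * (2 * π) by ring,
        ← zero_add ((k : ℝ) * (2 * π)), Real.sin_add_int_mul_two_pi, Real.sin_zero]
    rw [h m, h n, sub_zero, zero_div, ofReal_zero]

/-! ## Proposition 4.1: the matrix of the form of a functional on `[0, L]` -/

/-- **C–vS Proposition 4.1 (off-diagonal entries).** Let `D` be a real-linear functional on functions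
`ℝ → ℝ` depending only on the restriction to `[0, L]` (e.g. a distribution on `[0, L]`), and
`ψ(m) := D(y ↦ sin(2πm(1 - y/L)))/π`. Then for `m ≠ n` the matrix element
`q_{m,n} = D((U_m^* ∗ U_n)(y) + (U_m^* ∗ U_n)(-y))` equals `(ψ(m) - ψ(n))/(m - n)`.
[cite: ConnesSuijlekom2025, Proposition 4.1] -/
theorem functional_symAutocorr_of_ne {L : ℝ} (hL : 0 < L) (D : (ℝ → ℝ) →ₗ[ℝ] ℝ)
    (hD : ∀ f g : ℝ → ℝ, EqOn f g (Icc 0 L) → D f = D g) {m n : ℤ} (hmn : m ≠ n) :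
    D (fun y => (symAutocorr L m n y).re)
      = (D (fun y => Real.sin (2 * π * m * (1 - y / L))) / π
          - D (fun y => Real.sin (2 * π * n * (1 - y / L))) / π) / (m - n) := by
  have hmn' : ((m : ℝ) - (n : ℝ)) ≠ 0 := by
    rw [sub_ne_zero]
    exact_mod_cast hmn
  -- on `[0, L]` the kernel is the real function (4.4)
  have h1 : D (fun y => (symAutocorr L m n y).re)
      = D (fun y => (Real.sin (2 * π * m * y / L) - Real.sin (2 * π * n * y / L)) / (π * (n - m))) := by
    refine hD _ _ fun y hy => ?_
    simp only [symAutocorr_of_ne hL hmn hy, ofReal_re]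
  -- `sin(2πm(1 - y/L)) = -sin(2πmy/L)` for integer `m`
  have h2 : ∀ k : ℤ, (fun y : ℝ => Real.sin (2 * π * k * (1 - y / L)))
      = fun y => -Real.sin (2 * π * k * y / L) := by
    intro k
    funext y
    rw [show 2 * π * k * (1 - y / L) = -(2 * π * k * y / L) + k * (2 * π) by ring,
      Real.sin_add_int_mul_two_pi, Real.sin_neg]
  have h3 : (fun y : ℝ => (Real.sin (2 * π * m * y / L) - Real.sin (2 * π * n * y / L)) / (π * (n - m)))
      = (1 / (π * (n - m)) : ℝ) • ((fun y : ℝ => Real.sin (2 * π * m * y / L))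
          - fun y : ℝ => Real.sin (2 * π * n * y / L)) := by
    funext y
    simp only [Pi.smul_apply, Pi.sub_apply, smul_eq_mul]
    ring
  rw [h1, h3, map_smul, map_sub, h2 m, h2 n, smul_eq_mul]
  have h4 : ∀ k : ℤ, D (fun y => -Real.sin (2 * π * k * y / L))
      = -D (fun y => Real.sin (2 * π * k * y / L)) := by
    intro k
    rw [← map_neg]
    rfl
  have hnm' : ((n : ℝ) - (m : ℝ)) ≠ 0 := by
    rw [sub_ne_zero]
    exact_mod_cast (Ne.symm hmn)
  rw [h4 m, h4 n]
  generalize D (fun y => Real.sin (2 * π * m * y / L)) = A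
  generalize D (fun y => Real.sin (2 * π * n * y / L)) = B
  field_simp
  ring

/-- **C–vS Proposition 4.1 (diagonal entries).** With `D` as above, the diagonal matrix element
`q_{n,n} = D((U_n^* ∗ U_n)(y) + (U_n^* ∗ U_n)(-y))` equals `D(y ↦ 2(1 - y/L) cos(2πny/L))` (printed as
`ψ'(n)`, the derivative at `x = n` of `ψ(x) = D(y ↦ sin(2πx(1 - y/L)))/π` taken under `D`).
[cite: ConnesSuijlekom2025, Proposition 4.1] -/
theorem functional_symAutocorr_self {L : ℝ} (hL : 0 < L) (D : (ℝ → ℝ) →ₗ[ℝ] ℝ)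
    (hD : ∀ f g : ℝ → ℝ, EqOn f g (Icc 0 L) → D f = D g) (n : ℤ) :
    D (fun y => (symAutocorr L n n y).re) = D (fun y => 2 * (1 - y / L) * Real.cos (2 * π * n * y / L)) := by
  refine hD _ _ fun y hy => ?_
  simp only [symAutocorr_self hL n hy, ofReal_re]

/-- The entries of `sectionMatrix`. [cite: ConnesSuijlekom2025, eq. (4.3)] -/
theorem sectionMatrix_apply (D : (ℝ → ℝ) →ₗ[ℝ] ℝ) (L : ℝ) (S : Finset ℤ) (m n : S) :
    sectionMatrix D L S m n = D fun y => (symAutocorr L m n y).re := rfl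

/-- **Prop. 4.1 in matrix form:** the finite sections of the form of `D` are divided-difference matrices
`q_{mn} = (b_m - b_n)/(m - n)` (`m ≠ n`) with `b_m = ψ(m)` ODD in `m`.
[cite: ConnesSuijlekom2025, Proposition 4.1 and Proposition 4.2 (first sentence)] -/
theorem sectionMatrix_dividedDifference {L : ℝ} (hL : 0 < L) (D : (ℝ → ℝ) →ₗ[ℝ] ℝ)
    (hD : ∀ f g : ℝ → ℝ, EqOn f g (Icc 0 L) → D f = D g) (S : Finset ℤ) :
    (∀ i j : S, (i : ℤ) = -(j : ℤ) →
        D (fun y => Real.sin (2 * π * (i : ℤ) * (1 - y / L))) / π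
          = -(D (fun y => Real.sin (2 * π * (j : ℤ) * (1 - y / L))) / π)) ∧
      ∀ i j : S, i ≠ j → sectionMatrix D L S i j
        = (D (fun y => Real.sin (2 * π * (i : ℤ) * (1 - y / L))) / π
            - D (fun y => Real.sin (2 * π * (j : ℤ) * (1 - y / L))) / π)
          / (((i : ℤ) : ℝ) - ((j : ℤ) : ℝ)) := by
  refine ⟨fun i j hij => ?_, fun i j hij => ?_⟩
  · rw [hij, ← neg_div, ← map_neg]
    congr 2
    funext y
    rw [Pi.neg_apply, ← Real.sin_neg]
    congr 1
    push_cast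
    ring
  · rw [sectionMatrix_apply]
    exact functional_symAutocorr_of_ne hL D hD fun h => hij (Subtype.ext h)

/-! ## Finite sections: simple even bottom eigenvalue ⇒ real zeros -/

/-- **Finite-section real-zeros theorem** (C–vS Prop. 4.1 + Thm. 5.6; the finite-`N` step of the proof of
C–vS Thm. 6.1, and — with Weil's distribution as `D`, not formalised — the content of
Connes–Consani–Moscovici Thm. 5.10 (iii) / Connes' Letter Thm. 6.1 at finite `N`). Let `D` be any
real-linear functional on functions on `[0, L]`, `S = -S` a finite set of frequencies, and `q = sectionMatrix D L S`
the finite section of its form (4.3). If the smallest eigenvalue `ε` of `q` is SIMPLE with EVEN eigenvector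
`ξ` — precisely: `q - ε` is positive semidefinite, `ξ ≠ 0`, `(q - ε) ξ = 0`, every kernel vector of
`q - ε` is a multiple of `ξ`, and `ξ_{-k} = ξ_k` — then every zero `z ∈ ℂ` of the Fourier transform
`∫_0^L (Σ_{k ∈ S} ξ_k e^{2πikx/L}) e^{-izx} dx` of `ξ(x) = Σ ξ_k e^{2πikx/L}` (on `[0, L]`, zero outside)
is real. [cite: ConnesSuijlekom2025, Theorem 5.6 (ii) with Proposition 4.1 (proof of Theorem 6.1)] -/
theorem functional_finiteSection_zeros_real {L : ℝ} (hL : 0 < L) (D : (ℝ → ℝ) →ₗ[ℝ] ℝ)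
    (hD : ∀ f g : ℝ → ℝ, EqOn f g (Icc 0 L) → D f = D g) (S : Finset ℤ) (hS : ∀ j ∈ S, -j ∈ S)
    {ε : ℝ} {ξ : S → ℝ}
    (hpsd : (sectionMatrix D L S - ε • (1 : Matrix S S ℝ)).PosSemidef) (hξ0 : ξ ≠ 0)
    (hker0 : (sectionMatrix D L S - ε • (1 : Matrix S S ℝ)).mulVec ξ = 0)
    (hker : ∀ v : S → ℝ, (sectionMatrix D L S - ε • (1 : Matrix S S ℝ)).mulVec v = 0 →
      ∃ c : ℝ, v = c • ξ)
    (heven : ∀ i j : S, (i : ℤ) = -(j : ℤ) → ξ i = ξ j) {z : ℂ}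
    (hz : ∫ x in (0 : ℝ)..L, (∑ k : S, (ξ k : ℂ) * cexp (2 * π * I * ((k : ℤ) : ℂ) * (x : ℂ) / (L : ℂ)))
      * cexp (-(I * z * (x : ℂ))) = 0) :
    z.im = 0 := by
  obtain ⟨hb, hoff⟩ := sectionMatrix_dividedDifference hL D hD S
  refine Literature.LinearAlgebra.Matrix.ConnesVanSuijlekom.fourierIntegral_eq_zero_im_eq_zero_of_length
    S hS (b := fun m : S => D (fun y => Real.sin (2 * π * (m : ℤ) * (1 - y / L))) / π)
    (Q := sectionMatrix D L S - ε • (1 : Matrix S S ℝ)) hb ?_ hpsd hξ0 hker0 hker heven hL hz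
  intro i j hij
  rw [Matrix.sub_apply, Matrix.smul_apply, Matrix.one_apply_ne hij, smul_zero, sub_zero]
  exact hoff i j hij

/-! ## The multiplicative window `[λ⁻¹, λ]` (Connes–Consani–Moscovici normalisation) -/

/-- **Finite-section real-zeros theorem in the Connes–Consani–Moscovici normalisation**
(*Zeta spectral triples*, Prop. 5.9 and Thm. 5.10 (iii), at finite `N`): `λ > 1`, `L = 2 log λ`,
`V_k(u) = U_k(log(λu))` on `[λ⁻¹, λ]`, the multiplicative Fourier transform
`F_μ(f)(z) = ∫ f(u) u^{-iz} d^*u` (`d^*u = du/u`). For `ξ(u) = Σ_{k ∈ S} ξ_k e^{2πik log(λu)/L}` on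
`[λ⁻¹, λ]` (zero outside; the factor `L^{-1/2}` of `V_k` is dropped, it does not move zeros) and the
finite section `sectionMatrix D L S` of the form of ANY real-linear functional `D` on `[0, L]` (for
CCM: Weil's functional, not formalised here) with simple EVEN bottom eigenvector `ξ` as in
`functional_finiteSection_zeros_real`, every zero of `F_μ(ξ)` is real. Reduction to the additive
window by CCM's substitution `x = log(λu)`, `u^{-iz} = λ^{iz} e^{-izx}`, `d^*u = dx` (proof of Prop. 5.9).
[cite: ConnesConsaniMoscovici2025, Proposition 5.9 and Theorem 5.10 (iii)] -/
theorem functional_finiteSection_mulFourier_zeros_real {lam : ℝ} (hlam : 1 < lam)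
    (D : (ℝ → ℝ) →ₗ[ℝ] ℝ)
    (hD : ∀ f g : ℝ → ℝ, EqOn f g (Icc 0 (2 * Real.log lam)) → D f = D g)
    (S : Finset ℤ) (hS : ∀ j ∈ S, -j ∈ S) {ε : ℝ} {ξ : S → ℝ}
    (hpsd : (sectionMatrix D (2 * Real.log lam) S - ε • (1 : Matrix S S ℝ)).PosSemidef) (hξ0 : ξ ≠ 0)
    (hker0 : (sectionMatrix D (2 * Real.log lam) S - ε • (1 : Matrix S S ℝ)).mulVec ξ = 0)
    (hker : ∀ v : S → ℝ, (sectionMatrix D (2 * Real.log lam) S - ε • (1 : Matrix S S ℝ)).mulVec v = 0 →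
      ∃ c : ℝ, v = c • ξ)
    (heven : ∀ i j : S, (i : ℤ) = -(j : ℤ) → ξ i = ξ j) {z : ℂ}
    (hz : ∫ u in lam⁻¹..lam,
      (∑ k : S, (ξ k : ℂ) * cexp (2 * π * I * ((k : ℤ) : ℂ) * (Real.log (lam * u) : ℂ)
          / ((2 * Real.log lam : ℝ) : ℂ)))
        * cexp (-(I * z * (Real.log u : ℂ))) * ((u⁻¹ : ℝ) : ℂ) = 0) :
    z.im = 0 := by
  set L : ℝ := 2 * Real.log lam with hLdef
  have hlam0 : 0 < lam := one_pos.trans hlam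
  have hL : 0 < L := mul_pos two_pos (Real.log_pos hlam)
  -- the substitution `u = f(x) = λ⁻¹ eˣ`, `f' = f ≥ 0`, `f(0) = λ⁻¹`, `f(L) = λ`
  set f : ℝ → ℝ := fun x => lam⁻¹ * Real.exp x with hfdef
  have hfd : ∀ x, HasDerivAt f (f x) x := fun x => by
    simpa [hfdef] using (Real.hasDerivAt_exp x).const_mul lam⁻¹
  have hf0 : f 0 = lam⁻¹ := by simp [hfdef]
  have hfL : f L = lam := by
    have h2 : Real.exp L = lam ^ 2 := by
      rw [hLdef, show 2 * Real.log lam = Real.log lam + Real.log lam by ring, Real.exp_add,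
        Real.exp_log hlam0, sq]
    simp only [hfdef, h2]
    field_simp
  have hsub := intervalIntegral.integral_deriv_smul_comp_of_deriv_nonneg (a := 0) (b := L)
    (f := f) (f' := f)
    (g := fun u : ℝ => (∑ k : S, (ξ k : ℂ) * cexp (2 * π * I * ((k : ℤ) : ℂ) * (Real.log (lam * u) : ℂ)
        / ((L : ℝ) : ℂ))) * cexp (-(I * z * (Real.log u : ℂ))) * ((u⁻¹ : ℝ) : ℂ))
    (fun x _ => (hfd x).continuousAt.continuousWithinAt) (fun x _ => hfd x)
    (fun x _ => by positivity)
  rw [hf0, hfL, hz] at hsub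
  -- the integrand after substitution: `λ^{iz} · (Σ ξ_k e^{2πikx/L}) e^{-izx}`
  have hpt : EqOn (fun x => f x • ((fun u : ℝ => (∑ k : S, (ξ k : ℂ) * cexp (2 * π * I * ((k : ℤ) : ℂ)
        * (Real.log (lam * u) : ℂ) / ((L : ℝ) : ℂ))) * cexp (-(I * z * (Real.log u : ℂ))) * ((u⁻¹ : ℝ) : ℂ)) ∘ f) x)
      (fun x => cexp (I * z * (Real.log lam : ℂ)) * ((∑ k : S, (ξ k : ℂ) * cexp (2 * π * I * ((k : ℤ) : ℂ)
        * (x : ℂ) / (L : ℂ))) * cexp (-(I * z * (x : ℂ))))) (uIcc 0 L) := by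
    intro x _
    have hfx : f x = lam⁻¹ * Real.exp x := rfl
    have hfx0 : (f x : ℂ) ≠ 0 := by
      rw [hfx]
      exact_mod_cast (mul_pos (inv_pos.mpr hlam0) (Real.exp_pos x)).ne'
    have hlog1 : Real.log (lam * f x) = x := by
      rw [hfx, ← mul_assoc, mul_inv_cancel₀ hlam0.ne', one_mul, Real.log_exp]
    have hlog2 : Real.log (f x) = x - Real.log lam := by
      rw [hfx, Real.log_mul (inv_ne_zero hlam0.ne') (Real.exp_pos x).ne', Real.log_inv, Real.log_exp]
      ring
    simp only [Function.comp_apply, Complex.real_smul, hlog1, hlog2]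
    have e : cexp (-(I * z * ((x - Real.log lam : ℝ) : ℂ)))
        = cexp (I * z * (Real.log lam : ℂ)) * cexp (-(I * z * (x : ℂ))) := by
      rw [← Complex.exp_add]
      congr 1
      push_cast
      ring
    rw [e, Complex.ofReal_inv]
    calc (f x : ℂ) * ((∑ k : S, (ξ k : ℂ) * cexp (2 * π * I * ((k : ℤ) : ℂ) * (x : ℂ) / (L : ℂ)))
          * (cexp (I * z * (Real.log lam : ℂ)) * cexp (-(I * z * (x : ℂ)))) * ((f x : ℂ))⁻¹)
        = ((f x : ℂ) * ((f x : ℂ))⁻¹) * (cexp (I * z * (Real.log lam : ℂ))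
          * ((∑ k : S, (ξ k : ℂ) * cexp (2 * π * I * ((k : ℤ) : ℂ) * (x : ℂ) / (L : ℂ)))
            * cexp (-(I * z * (x : ℂ))))) := by ring
      _ = _ := by rw [mul_inv_cancel₀ hfx0, one_mul]
  rw [intervalIntegral.integral_congr hpt, intervalIntegral.integral_const_mul] at hsub
  have hint : ∫ x in (0 : ℝ)..L, (∑ k : S, (ξ k : ℂ) * cexp (2 * π * I * ((k : ℤ) : ℂ) * (x : ℂ) / (L : ℂ)))
      * cexp (-(I * z * (x : ℂ))) = 0 :=
    (mul_eq_zero.mp hsub).resolve_left (Complex.exp_ne_zero _)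
  exact functional_finiteSection_zeros_real hL D hD S hS hpsd hξ0 hker0 hker heven hint

end ConnesVanSuijlekom

end Literature.Analysis.Fourier
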